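import Mathlib
import Summits.ValiantsHypothesis.ValiantsHypothesis.Theses.ValuativeGCT
import Literature.Computability.AlgebraicComplexity.OrbitClosureWeights
import Summits.ValiantsHypothesis.ValiantsHypothesis.Theorems.ValuativeGCTValuativeFlipGrowthGap
import Summits.ValiantsHypothesis.ValiantsHypothesis.Theorems.ValuativeGCTValuativeFlipStabInvLeExplicit
import Summits.ValiantsHypothesis.ValiantsHypothesis.Theorems.ValuativeGCTValuativeFlipFourRowSliceBound
import Summits.ValiantsHypothesis.ValiantsHypothesis.Theorems.ValuativeGCTValuativeFlipFourRowHilbertLowerBound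
import Summits.ValiantsHypothesis.ValiantsHypothesis.Theorems.ValuativeGCTHeadFlipFourRowBridge
import Summits.ValiantsHypothesis.ValiantsHypothesis.Theorems.ValuativeGCTValuativeFlipFourRowGctObstruction
import Summits.ValiantsHypothesis.ValiantsHypothesis.Theorems.ValuativeGCTValuativeFlipFourRowTransfer
import Summits.ValiantsHypothesis.ValiantsHypothesis.Theorems.ValuativeGCTValuativeFlipHeadOfPencilCertificate

/-!
# The four-row head census, POINTWISE: from one rank bound to a flip at one window position

Helper file (`--supports stmt-ValiantsHypothesis-12624`) for crux `ValuativeGCT.ValuativeFlip`, line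
`four-row-count` (`Cruxes/ValuativeFlip/Lines/four_row_count.lean`), wall-breaker axis k14 "small cases
certified".  The line's glue `headCensus_of` / `headFlipBody_of` composes its four head stubs for ALL
large `n`; three of them are theorems of the tree (`stub_fourRowSliceBound` p112540,
`stub_fourRowHilbertLowerBound` p117325, `HeadFlip.stub_fourRowBridge`), so at ONE position `(n, m)` the only
input left is a four-row tangent rank bound `2m² + m + 2 ≤ dim span{X_a · (∂_b (g·pp))|₄}` for ONE `g`.
That pointwise composition is `headCensus_at` / `headFlipBody_of_pencilCert_at` of
`Theorems/ValuativeGCTValuativeFlipHeadOfPencilCertificate.lean` (k5 gen 1); this file adds the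
remaining pointwise corollaries, sorry-free:

* `fourRow_flipBody_of_rank` — the body of the crux `ValuativeGCT.ValuativeFlip` at `(n, m)` from a rank
  bound at a base point `g` (verbatim `let χ`, `let T`; centre `U = ⊥`, `r = 0`, `T_⊥ ≤ Hom ⊓ SAND` by
  `stub_stabInv_le_explicit`);
* `fourRow_detObstruction_of_rank` — a Mulmuley–Sohoni multiplicity obstruction at `(n, m)`:
  `mult_{λ*} ℂ[Δ(det_m)] < mult_{λ*} ℂ[Δ_m(X₀₀^{m-n} per_n)]` on a four-row shape
  (`fourRow_detOrbitMultiplicity_lt_of_gap` on the gap from growth gap + Hilbert bound + slice bound);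
* `fourRow_census_of_pencilRank`, `fourRow_detObstruction_of_pencilRank` — census and obstruction from an
  `m`-FREE four-variable pencil certificate at inner size `n` (`frt_finrank_fourRowSpan_ge`):
  `2m² + m + 2 ≤ dim span{X_t · (∂_{kl} per_n)(M·X)}`.

The certified pencil ranks (`Theorems/ValuativeGCTValuativeFlipPencilEvalCheck.lean`,
`le_finrank_of_pencilCheck` + `native_decide` instances) then give flips and obstructions at the first
positions ABOVE the bottom of the window, `(n, m) = (9, 10), (10, 11), …`.
[this crux's line four-row-count (glue `headCensus_of`, `headFlipBody_of`); …HeadOfPencilCertificate.lean; Mulmuley–Sohoni 2008;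
BLMW 2011 §5.2] [folklore]
-/

set_option linter.dupNamespace false
set_option maxHeartbeats 800000

namespace Summit.ValiantsHypothesis.ValiantsHypothesis.Theorems.ValuativeFlip

open MvPolynomial
open scoped BigOperators Matrix
open Literature.NumberTheory.DiophantineGeometry
open Literature.Computability.AlgebraicComplexity

noncomputable section

/-- **The crux body at one window position from a rank bound**: under the same hypothesis the body of
`ValuativeGCT.ValuativeFlip` holds at `(n, m)` (verbatim `let χ`, `let T`), with the no-cut centre
`U = ⊥`, `r = 0` (`T_⊥ ≤ Hom ⊓ SAND ⊓ HWSP`, `stub_stabInv_le_explicit`) — the line's `headFlipBody_of`,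
pointwise. [this crux's line four-row-count] [folklore] -/
theorem fourRow_flipBody_of_rank
    (n m : ℕ) [NeZero m] (hnm : n ≤ m) (hm2 : 2 ≤ m) (g : GL (MatIdx m) ℂ)
    (hg : 2 * m ^ 2 + m + 2 ≤ Module.finrank ℂ ↥(Submodule.span ℂ (Set.range fun ab : {a : MatIdx m // m * m ≤ (((matIdxEquiv m).symm a : Fin (m * m)) : ℕ) + 4} × MatIdx m => (MvPolynomial.X ab.1.1 : MvPolynomial (MatIdx m) ℂ) * MvPolynomial.aeval (fun i : MatIdx m => if m * m ≤ (((matIdxEquiv m).symm i : Fin (m * m)) : ℕ) + 4 then (MvPolynomial.X i : MvPolynomial (MatIdx m) ℂ) else 0) (MvPolynomial.pderiv ab.2 (linSubst (MatIdx m) ℂ ((g : GL (MatIdx m) ℂ) : Matrix (MatIdx m) (MatIdx m) ℂ) (paddedPerFormLex ℂ n m)))))) :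
      ∃ (U : Submodule ℂ (MatIdx m → ℂ)) (r δ : ℕ) (lam : Nat.Partition (m * δ)), (∀ u ∈ U, (Matrix.of fun a b : Fin m => u (toLex (a, b))).rank ≤ r) ∧ lam.parts.card ≤ m * m ∧ (let χ : Weight (MatIdx m) := (Weight.dualOfPartition (m * m) lam).toMatIdx; let T : Submodule ℂ (MvPolynomial (MatIdx m × MatIdx m) ℂ) := MvPolynomial.homogeneousSubmodule (MatIdx m × MatIdx m) ℂ (m * δ) ⊓ ((MvPolynomial.vanishingIdeal ℂ {p : MatIdx m × MatIdx m → ℂ | ∀ j : MatIdx m, (fun i => p (j, i)) ∈ U}) ^ (δ * (m - r))).restrictScalars ℂ ⊓ (⨅ (M : Matrix (MatIdx m) (MatIdx m) ℂ) (_ : linSubst (MatIdx m) ℂ M (detFormLex ℂ m) = detFormLex ℂ m), LinearMap.ker ((MvPolynomial.aeval (R := ℂ) fun p : MatIdx m × MatIdx m => ∑ l : MatIdx m, M l p.2 • MvPolynomial.X (p.1, l)).toLinearMap - LinearMap.id (R := ℂ) (M := MvPolynomial (MatIdx m × MatIdx m) ℂ))) ⊓ (⨅ (g : Matrix.GeneralLinearGroup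 (MatIdx m) ℂ) (_ : IsUpperTriangular g), LinearMap.ker ((MvPolynomial.aeval (R := ℂ) fun p : MatIdx m × MatIdx m => ∑ l : MatIdx m, ((g⁻¹ : Matrix.GeneralLinearGroup (MatIdx m) ℂ) : Matrix (MatIdx m) (MatIdx m) ℂ) p.1 l • MvPolynomial.X (l, p.2)).toLinearMap - weightChar χ g • LinearMap.id (R := ℂ) (M := MvPolynomial (MatIdx m × MatIdx m) ℂ))); Module.finrank ℂ ↥T < orbitMultiplicity ℂ (paddedPerFormLex ℂ n m) m χ) := by
  obtain ⟨δ, lam, hcard, hlt⟩ := headCensus_at n m hnm hm2 g hg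
  refine ⟨⊥, 0, δ, lam, ?_, ?_, ?_⟩
  · intro u hu
    rw [Submodule.mem_bot] at hu
    subst hu
    have h0 : (Matrix.of fun a b : Fin m => (0 : MatIdx m → ℂ) (toLex (a, b))) = 0 := by
      ext a b
      simp
    rw [h0, Matrix.rank_zero]
  · exact hcard.trans (by nlinarith)
  · intro χ T
    haveI : Module.Finite ℂ ↥(MvPolynomial.homogeneousSubmodule (MatIdx m × MatIdx m) ℂ (m * δ)) :=
      Module.Finite.iff_fg.mpr (MvPolynomial.homogeneousSubmodule_fg (MatIdx m × MatIdx m) ℂ (m * δ))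
    haveI : Module.Finite ℂ ↥(MvPolynomial.homogeneousSubmodule (MatIdx m × MatIdx m) ℂ (m * δ) ⊓
          (⨅ (P : Matrix (Fin m) (Fin m) ℂ) (Q : Matrix (Fin m) (Fin m) ℂ) (_ : P.det = 1) (_ : Q.det = 1), LinearMap.ker ((MvPolynomial.aeval fun p : MatIdx m × MatIdx m => ∑ l : MatIdx m, (P (ofLex p.2).1 (ofLex l).1 * Q (ofLex l).2 (ofLex p.2).2) • (MvPolynomial.X (p.1, l) : MvPolynomial (MatIdx m × MatIdx m) ℂ)).toLinearMap - (LinearMap.id : MvPolynomial (MatIdx m × MatIdx m) ℂ →ₗ[ℂ] MvPolynomial (MatIdx m × MatIdx m) ℂ))) ⊓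
          (⨅ (g : Matrix.GeneralLinearGroup (MatIdx m) ℂ) (_ : IsUpperTriangular g), LinearMap.ker ((MvPolynomial.aeval fun p : MatIdx m × MatIdx m => ∑ l : MatIdx m, ((g⁻¹ : Matrix.GeneralLinearGroup (MatIdx m) ℂ) : Matrix (MatIdx m) (MatIdx m) ℂ) p.1 l • (MvPolynomial.X (l, p.2) : MvPolynomial (MatIdx m × MatIdx m) ℂ)).toLinearMap - weightChar ((Weight.dualOfPartition (m * m) lam).toMatIdx : Weight (MatIdx m)) g • (LinearMap.id : MvPolynomial (MatIdx m × MatIdx m) ℂ →ₗ[ℂ] MvPolynomial (MatIdx m × MatIdx m) ℂ)))) :=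
      Submodule.finiteDimensional_of_le (inf_le_left.trans inf_le_left)
    exact lt_of_le_of_lt (Submodule.finrank_mono (inf_le_inf (le_inf (inf_le_left.trans inf_le_left)
      (inf_le_right.trans ((stub_stabInv_le_explicit m).trans inf_le_left))) le_rfl)) hlt

/-- **A Mulmuley–Sohoni multiplicity obstruction at one window position from a rank bound**: under the
same hypothesis some `λ ⊢ mδ` with `ℓ(λ) ≤ 4` has
`mult_{λ*} ℂ[Δ(det_m)] < mult_{λ*} ℂ[Δ_m(X₀₀^{m-n} per_n)]` (`fourRow_detOrbitMultiplicity_lt_of_gap` on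
the gap produced by growth gap + Hilbert lower bound + slice bound). [Mulmuley–Sohoni 2008; BLMW 2011
§5.2; this crux's line four-row-count] [folklore] -/
theorem fourRow_detObstruction_of_rank
    (n m : ℕ) [NeZero m] (hnm : n ≤ m) (hm2 : 2 ≤ m) (g : GL (MatIdx m) ℂ)
    (hg : 2 * m ^ 2 + m + 2 ≤ Module.finrank ℂ ↥(Submodule.span ℂ (Set.range fun ab : {a : MatIdx m // m * m ≤ (((matIdxEquiv m).symm a : Fin (m * m)) : ℕ) + 4} × MatIdx m => (MvPolynomial.X ab.1.1 : MvPolynomial (MatIdx m) ℂ) * MvPolynomial.aeval (fun i : MatIdx m => if m * m ≤ (((matIdxEquiv m).symm i : Fin (m * m)) : ℕ) + 4 then (MvPolynomial.X i : MvPolynomial (MatIdx m) ℂ) else 0) (MvPolynomial.pderiv ab.2 (linSubst (MatIdx m) ℂ ((g : GL (MatIdx m) ℂ) : Matrix (MatIdx m) (MatIdx m) ℂ) (paddedPerFormLex ℂ n m)))))) :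
    ∃ (δ : ℕ) (lam : Nat.Partition (m * δ)), lam.parts.card ≤ 4 ∧
      orbitMultiplicity ℂ (detFormLex ℂ m) m ((Weight.dualOfPartition (m * m) lam).toMatIdx : Weight (MatIdx m)) <
        orbitMultiplicity ℂ (paddedPerFormLex ℂ n m) m ((Weight.dualOfPartition (m * m) lam).toMatIdx : Weight (MatIdx m)) := by
  have hzN : (2 * m ^ 2 + m) + 1 ≤ 2 * m ^ 2 + m + 1 := le_rfl
  obtain ⟨δ, hδ⟩ := stub_growthGap m (2 * m ^ 2 + m) (2 * m ^ 2 + m + 1) hzN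
  have hN : (2 * m ^ 2 + m + 1) + 1 ≤ Module.finrank ℂ ↥(Submodule.span ℂ (Set.range fun ab : {a : MatIdx m // m * m ≤ (((matIdxEquiv m).symm a : Fin (m * m)) : ℕ) + 4} × MatIdx m => (MvPolynomial.X ab.1.1 : MvPolynomial (MatIdx m) ℂ) * MvPolynomial.aeval (fun i : MatIdx m => if m * m ≤ (((matIdxEquiv m).symm i : Fin (m * m)) : ℕ) + 4 then (MvPolynomial.X i : MvPolynomial (MatIdx m) ℂ) else 0) (MvPolynomial.pderiv ab.2 (linSubst (MatIdx m) ℂ ((g : GL (MatIdx m) ℂ) : Matrix (MatIdx m) (MatIdx m) ℂ) (paddedPerFormLex ℂ n m))))) := by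
    have h22 : (2 * m ^ 2 + m + 1) + 1 = 2 * m ^ 2 + m + 2 := by ring
    rw [h22]
    exact hg
  have h3 := stub_fourRowHilbertLowerBound n m hnm g (2 * m ^ 2 + m + 1) δ hN
  have h1 := stub_fourRowSliceBound m hm2 (m * δ)
  have hgap := lt_of_le_of_lt h1 (lt_of_lt_of_le hδ h3)
  obtain ⟨lam, hcard, hlt⟩ := fourRow_detOrbitMultiplicity_lt_of_gap n m δ hnm hm2 hgap
  exact ⟨δ, lam, hcard, hlt⟩

/-! ## The same three from an `m`-free pencil certificate at inner size `n` -/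

/-- **Census from a pencil certificate.**  A four-variable pencil `M` at inner size `n` with four cells
`c t'` carrying independent forms and `2m² + m + 2 ≤ dim span{X_t · (∂_{kl} per_n)(M·X)}` gives the
four-row census at `(n, m)` for every `m ≥ n`, `m ≥ 2` (`frt_finrank_fourRowSpan_ge` realises and
transfers the pencil span into the four-row tangent span of some `g · X₀₀^{m-n} per_n`).
[this crux's line four-row-count; folklore] -/
theorem fourRow_census_of_pencilRank (n m : ℕ) [NeZero m] (hnm : n ≤ m) (hm2 : 2 ≤ m)
    (M : Fin n × Fin n → Fin 4 → ℂ) (c : Fin 4 → Fin n × Fin n)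
    (hc : IsUnit (Matrix.of fun t t' : Fin 4 => M (c t') t))
    (hM : 2 * m ^ 2 + m + 2 ≤ Module.finrank ℂ ↥(Submodule.span ℂ (Set.range fun tc : Fin 4 × (Fin n × Fin n) =>
        (X tc.1 : MvPolynomial (Fin 4) ℂ) *
          aeval (fun ij : Fin n × Fin n => ∑ t : Fin 4, M ij t • (X t : MvPolynomial (Fin 4) ℂ))
            (pderiv tc.2 (perPoly (Fin n) ℂ))))) :
    ∃ (δ : ℕ) (lam : Nat.Partition (m * δ)), lam.parts.card ≤ 4 ∧
        Module.finrank ℂ ↥(MvPolynomial.homogeneousSubmodule (MatIdx m × MatIdx m) ℂ (m * δ) ⊓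
          (⨅ (P : Matrix (Fin m) (Fin m) ℂ) (Q : Matrix (Fin m) (Fin m) ℂ) (_ : P.det = 1) (_ : Q.det = 1), LinearMap.ker ((MvPolynomial.aeval fun p : MatIdx m × MatIdx m => ∑ l : MatIdx m, (P (ofLex p.2).1 (ofLex l).1 * Q (ofLex l).2 (ofLex p.2).2) • (MvPolynomial.X (p.1, l) : MvPolynomial (MatIdx m × MatIdx m) ℂ)).toLinearMap - (LinearMap.id : MvPolynomial (MatIdx m × MatIdx m) ℂ →ₗ[ℂ] MvPolynomial (MatIdx m × MatIdx m) ℂ))) ⊓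
          (⨅ (g : Matrix.GeneralLinearGroup (MatIdx m) ℂ) (_ : IsUpperTriangular g), LinearMap.ker ((MvPolynomial.aeval fun p : MatIdx m × MatIdx m => ∑ l : MatIdx m, ((g⁻¹ : Matrix.GeneralLinearGroup (MatIdx m) ℂ) : Matrix (MatIdx m) (MatIdx m) ℂ) p.1 l • (MvPolynomial.X (l, p.2) : MvPolynomial (MatIdx m × MatIdx m) ℂ)).toLinearMap - weightChar ((Weight.dualOfPartition (m * m) lam).toMatIdx : Weight (MatIdx m)) g • (LinearMap.id : MvPolynomial (MatIdx m × MatIdx m) ℂ →ₗ[ℂ] MvPolynomial (MatIdx m × MatIdx m) ℂ)))) <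
        orbitMultiplicity ℂ (paddedPerFormLex ℂ n m) m ((Weight.dualOfPartition (m * m) lam).toMatIdx : Weight (MatIdx m)) := by
  obtain ⟨g, hg⟩ := frt_finrank_fourRowSpan_ge n m hnm hm2 M c hc
  exact headCensus_at n m hnm hm2 g (hM.trans hg)

/-- **Multiplicity obstruction from a pencil certificate** (same transfer). [Mulmuley–Sohoni 2008; this
crux's line four-row-count; folklore] -/
theorem fourRow_detObstruction_of_pencilRank (n m : ℕ) [NeZero m] (hnm : n ≤ m) (hm2 : 2 ≤ m)
    (M : Fin n × Fin n → Fin 4 → ℂ) (c : Fin 4 → Fin n × Fin n)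
    (hc : IsUnit (Matrix.of fun t t' : Fin 4 => M (c t') t))
    (hM : 2 * m ^ 2 + m + 2 ≤ Module.finrank ℂ ↥(Submodule.span ℂ (Set.range fun tc : Fin 4 × (Fin n × Fin n) =>
        (X tc.1 : MvPolynomial (Fin 4) ℂ) *
          aeval (fun ij : Fin n × Fin n => ∑ t : Fin 4, M ij t • (X t : MvPolynomial (Fin 4) ℂ))
            (pderiv tc.2 (perPoly (Fin n) ℂ))))) :
    ∃ (δ : ℕ) (lam : Nat.Partition (m * δ)), lam.parts.card ≤ 4 ∧
      orbitMultiplicity ℂ (detFormLex ℂ m) m ((Weight.dualOfPartition (m * m) lam).toMatIdx : Weight (MatIdx m)) <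
        orbitMultiplicity ℂ (paddedPerFormLex ℂ n m) m ((Weight.dualOfPartition (m * m) lam).toMatIdx : Weight (MatIdx m)) := by
  obtain ⟨g, hg⟩ := frt_finrank_fourRowSpan_ge n m hnm hm2 M c hc
  exact fourRow_detObstruction_of_rank n m hnm hm2 g (hM.trans hg)

end

end Summit.ValiantsHypothesis.ValiantsHypothesis.Theorems.ValuativeFlip
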